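import Literature.NumberTheory.LFunctions.MertensConstant
import Mathlib.NumberTheory.Chebyshev
import HarnessLib

/-!
# Mertens' product with an explicit `θ`-remainder (Rosser–Schoenfeld (4.20) form)

Topic: `Literature/NumberTheory/LFunctions`. Pure proof file (one auxiliary definition, the weight
`mertensWeight t = (1 + log t)/(t² log² t)`). From the tree's Mertens theorems with constants
(`MertensConstant.lean`: `∑_{p≤x} 1/p − log log x → B₁`, `B₁ = γ + ∑_p (log(1 − 1/p) + 1/p)`) we derive the
identity behind Rosser–Schoenfeld's (4.20) and Dusart's / Morrill–Platt's explicit Mertens products: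

* `primeRecipSum_sub_eq_theta` (partial summation, Mathlib's Abel summation with `c_p = log p`,
  `f(t) = 1/(t log t)`): for `2 ≤ x ≤ y`,
  `∑_{x<p≤y} 1/p = θ(y)/(y log y) − θ(x)/(x log x) + ∫_x^y θ(t)(1+log t)/(t² log²t) dt`;
* `primeRecipSum_sub_loglog_eq` : if `t ↦ (θ(t) − t)(1+log t)/(t² log² t)` is integrable on `(x, ∞)`
  (`x ≥ 2`), then `∑_{p≤x} 1/p − log log x = B₁ + E(x)` with the **exact remainder**
  `E(x) = (θ(x) − x)/(x log x) − ∫_x^∞ (θ(t) − t)(1+log t)/(t² log² t) dt` (Rosser–Schoenfeld 1962, (4.20));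
* `mertensLog_sub_loglog_le` : `∑_{p≤x} −log(1 − 1/p) ≤ log log x + γ + E(x)`, i.e.
  `prod_one_sub_inv_inv_le` : `∏_{p≤x} (1 − 1/p)⁻¹ ≤ e^γ · log x · e^{E(x)}` — the form in which
  θ-bounds (Schoenfeld, Dusart, Büthe, Broadbent–Kadiri–Lumley–Ng–Wilk) are fed into Robin-type
  inequalities (Morrill–Platt 2021, Lemma 5; Axler 2023, §2).

## References
* J. B. Rosser, L. Schoenfeld, *Approximate formulas for some functions of prime numbers*, Illinois J.
  Math. 6 (1962), 64–94, (4.13)–(4.20). [RosserSchoenfeld1962]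
* T. Morrill, D. Platt, *Robin's inequality for 20-free integers*, Integers 21 (2021), A28, Lemma 5
  (proof: "by 4.20 of [RS] …"). [MorrillPlatt2021]
* G. H. Hardy, E. M. Wright, *An Introduction to the Theory of Numbers*, 6th ed., Thms 427–429. [HardyWright2008]
-/

noncomputable section

open Real Filter Topology Set MeasureTheory Finset
open scoped Chebyshev

namespace Literature.NumberTheory.LFunctions

namespace RobinTFree

open Literature.NumberTheory.LFunctions.Mertens

/-- The weight `w(t) = (1 + log t)/(t² log² t) = −(d/dt) (1/(t log t))` of Rosser–Schoenfeld's
remainder integral. [cite: RosserSchoenfeld1962, (4.20)] -/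
def mertensWeight (t : ℝ) : ℝ := (1 + Real.log t) / (t ^ 2 * Real.log t ^ 2)

/-- Rosser–Schoenfeld's remainder `E(x) = (θ(x) − x)/(x log x) − ∫_x^∞ (θ(t) − t) w(t) dt` in Mertens'
second theorem. [cite: RosserSchoenfeld1962, (4.20)] -/
def mertensRemainder (x : ℝ) : ℝ :=
  (θ x - x) / (x * Real.log x) - ∫ t in Ioi x, (θ t - t) * mertensWeight t

/-! ### Measurability and partial sums of `θ` -/

/-- `θ` is measurable (it factors through `⌊·⌋₊`). [folklore] -/
private theorem measurable_theta : Measurable (fun x : ℝ => θ x) := by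
  have : (fun x : ℝ => θ x) = (fun n : ℕ => θ (n : ℝ)) ∘ Nat.floor := by
    funext x; simp [Chebyshev.theta_eq_theta_coe_floor x]
  rw [this]
  exact (measurable_from_nat (f := fun n : ℕ => θ (n : ℝ))).comp Nat.measurable_floor

/-- `∑_{k ≤ ⌊t⌋, k prime} log k = θ(t)`. [folklore] -/
private theorem sum_Icc_ite_prime_log (t : ℝ) :
    ∑ k ∈ Icc 0 ⌊t⌋₊, (if k.Prime then Real.log k else 0) = θ t := by
  rw [Chebyshev.theta_eq_sum_primesLE, ← Finset.sum_filter]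
  refine Finset.sum_congr ?_ fun _ _ => rfl
  ext p
  simp [Nat.mem_primesLE, and_comm]

/-- `P(x) = P(⌊x⌋)`. [folklore] -/
private theorem primeRecipSum_eq_natCast_floor (x : ℝ) : primeRecipSum x = primeRecipSum (⌊x⌋₊ : ℝ) := by
  rw [primeRecipSum, primeRecipSum, Nat.floor_natCast]

/-- `∑_{0<k≤n} [k prime]/k = P(n)`. [folklore] -/
private theorem sum_Ioc_ite_inv (n : ℕ) :
    ∑ k ∈ Ioc 0 n, (if k.Prime then (k : ℝ)⁻¹ else 0) = primeRecipSum n := by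
  rw [primeRecipSum, Nat.floor_natCast, Nat.primesLE_eq_filter_Ioc_zero, Finset.sum_filter]

/-! ### Partial summation in `θ`-form -/

/-- **Partial summation** (Rosser–Schoenfeld (4.13)–(4.14) form): for `2 ≤ x ≤ y`,
`∑_{x<p≤y} 1/p = θ(y)/(y log y) − θ(x)/(x log x) + ∫_x^y θ(t) (1+log t)/(t² log² t) dt`.
[cite: RosserSchoenfeld1962, (4.13)–(4.14)] -/
theorem primeRecipSum_sub_eq_theta {x y : ℝ} (hx : 2 ≤ x) (hxy : x ≤ y) :
    primeRecipSum y - primeRecipSum x =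
      θ y / (y * Real.log y) - θ x / (x * Real.log x) + ∫ t in Ioc x y, θ t * mertensWeight t := by
  set c : ℕ → ℝ := fun k => if k.Prime then Real.log k else 0 with hc
  set f : ℝ → ℝ := fun t => (t * Real.log t)⁻¹ with hf
  set g : ℝ → ℝ := fun t => -mertensWeight t with hg
  have hderiv : ∀ t : ℝ, 1 < t → HasDerivAt f (g t) t := by
    intro t ht
    have ht0 : t ≠ 0 := by linarith
    have hlog : Real.log t ≠ 0 := (Real.log_pos ht).ne'
    have h1 : HasDerivAt (fun t => t * Real.log t) (1 * Real.log t + t * t⁻¹) t :=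
      (hasDerivAt_id t).mul (Real.hasDerivAt_log ht0)
    have h2 : HasDerivAt f (-(1 * Real.log t + t * t⁻¹) / (t * Real.log t) ^ 2) t :=
      h1.inv (mul_ne_zero ht0 hlog)
    refine h2.congr_deriv ?_
    simp only [hg, mertensWeight]
    field_simp
    ring
  have hmem : ∀ t ∈ Set.Icc x y, 1 < t := fun t ht => by linarith [ht.1]
  have hgcont : ContinuousOn g (Set.Icc x y) := by
    have h0 : ∀ t ∈ Set.Icc x y, t ^ 2 * Real.log t ^ 2 ≠ 0 := fun t ht =>
      mul_ne_zero (pow_ne_zero _ (by linarith [ht.1])) (pow_ne_zero _ (Real.log_pos (hmem t ht)).ne')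
    have hsub : ∀ t ∈ Set.Icc x y, t ∈ ({0}ᶜ : Set ℝ) := fun t ht =>
      Set.mem_compl_singleton_iff.mpr (show (0:ℝ) < t by linarith [ht.1]).ne'
    refine ContinuousOn.neg (ContinuousOn.div ?_ ?_ h0)
    · exact continuousOn_const.add ((Real.continuousOn_log.mono hsub))
    · exact (continuousOn_pow 2).mul ((Real.continuousOn_log.mono hsub).pow 2)
  have hf_diff : ∀ t ∈ Set.Icc x y, DifferentiableAt ℝ f t := fun t ht =>
    (hderiv t (hmem t ht)).differentiableAt
  have hderiv_eq : Set.EqOn g (deriv f) (Set.Icc x y) := fun t ht => ((hderiv t (hmem t ht)).deriv).symm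
  have hf_int : IntegrableOn (deriv f) (Set.Icc x y) :=
    hgcont.integrableOn_Icc.congr_fun hderiv_eq measurableSet_Icc
  have habel := sum_mul_eq_sub_sub_integral_mul c (by linarith : (0 : ℝ) ≤ x) hxy hf_diff hf_int
  have hS : ∀ t : ℝ, ∑ k ∈ Icc 0 ⌊t⌋₊, c k = θ t := fun t => by rw [hc]; exact sum_Icc_ite_prime_log t
  have hfc : ∀ k : ℕ, f k * c k = if k.Prime then (k : ℝ)⁻¹ else 0 := by
    intro k
    simp only [hf, hc]
    split_ifs with hk
    · have hk1 : (1 : ℝ) < k := by exact_mod_cast hk.one_lt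
      have : Real.log k ≠ 0 := (Real.log_pos hk1).ne'
      field_simp
    · simp
  have hsum : ∀ n : ℕ, ∑ k ∈ Ioc 0 n, f k * c k = primeRecipSum n := fun n => by
    rw [← sum_Ioc_ite_inv]; exact Finset.sum_congr rfl fun k _ => hfc k
  have hxfl : 0 ≤ ⌊x⌋₊ := Nat.zero_le _
  have hlhs : ∑ k ∈ Ioc ⌊x⌋₊ ⌊y⌋₊, f k * c k = primeRecipSum y - primeRecipSum x := by
    rw [primeRecipSum_eq_natCast_floor y, primeRecipSum_eq_natCast_floor x, ← hsum, ← hsum,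
      eq_sub_iff_add_eq, add_comm, Finset.sum_Ioc_consecutive _ hxfl (Nat.floor_le_floor hxy)]
  have hbx : f x * ∑ k ∈ Icc 0 ⌊x⌋₊, c k = θ x / (x * Real.log x) := by rw [hS, hf]; ring
  have hby : f y * ∑ k ∈ Icc 0 ⌊y⌋₊, c k = θ y / (y * Real.log y) := by rw [hS, hf]; ring
  have hint : ∫ t in Set.Ioc x y, deriv f t * ∑ k ∈ Icc 0 ⌊t⌋₊, c k =
      -∫ t in Ioc x y, θ t * mertensWeight t := by
    rw [← integral_neg]
    refine setIntegral_congr_fun measurableSet_Ioc fun t ht => ?_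
    rw [← hderiv_eq (Set.Ioc_subset_Icc_self ht), hS, hg]
    ring
  rw [hlhs, hbx, hby, hint] at habel
  linarith

/-! ### The elementary integral `∫ t·w(t) dt = log log t − 1/log t` -/

/-- `∫_x^y (1 + log t)/(t log² t) dt = (log log y − 1/log y) − (log log x − 1/log x)` for `1 < x ≤ y`.
[folklore] -/
private theorem integral_id_mul_mertensWeight {x y : ℝ} (hx : 1 < x) (hxy : x ≤ y) :
    ∫ t in Ioc x y, t * mertensWeight t =
      (Real.log (Real.log y) - (Real.log y)⁻¹) - (Real.log (Real.log x) - (Real.log x)⁻¹) := by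
  set G : ℝ → ℝ := fun t => Real.log (Real.log t) - (Real.log t)⁻¹ with hG
  have hderiv : ∀ t ∈ Set.uIcc x y, HasDerivAt G (t * mertensWeight t) t := by
    intro t ht
    rw [Set.uIcc_of_le hxy] at ht
    have ht1 : 1 < t := lt_of_lt_of_le hx ht.1
    have ht0 : t ≠ 0 := by linarith
    have hlog : Real.log t ≠ 0 := (Real.log_pos ht1).ne'
    have h1 : HasDerivAt (fun t => Real.log (Real.log t)) (t⁻¹ / Real.log t) t :=
      (Real.hasDerivAt_log ht0).log hlog
    have h2 : HasDerivAt (fun t => (Real.log t)⁻¹) (-(t⁻¹) / (Real.log t) ^ 2) t :=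
      (Real.hasDerivAt_log ht0).inv hlog
    refine (h1.sub h2).congr_deriv ?_
    rw [mertensWeight]
    field_simp
    ring
  have hcont : ContinuousOn (fun t => t * mertensWeight t) (Set.uIcc x y) := by
    rw [Set.uIcc_of_le hxy]
    have hsub : ∀ t ∈ Set.Icc x y, t ∈ ({0}ᶜ : Set ℝ) := fun t ht =>
      Set.mem_compl_singleton_iff.mpr (show (0:ℝ) < t by linarith [ht.1]).ne'
    have h0 : ∀ t ∈ Set.Icc x y, t ^ 2 * Real.log t ^ 2 ≠ 0 := fun t ht =>
      mul_ne_zero (pow_ne_zero _ (by linarith [ht.1]))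
        (pow_ne_zero _ (Real.log_pos (lt_of_lt_of_le hx ht.1)).ne')
    refine continuousOn_id.mul (ContinuousOn.div ?_ ?_ h0)
    · exact continuousOn_const.add (Real.continuousOn_log.mono hsub)
    · exact (continuousOn_pow 2).mul ((Real.continuousOn_log.mono hsub).pow 2)
  rw [← intervalIntegral.integral_of_le hxy,
    intervalIntegral.integral_eq_sub_of_hasDerivAt hderiv (hcont.intervalIntegrable)]

/-! ### The deviation `P(x) − log log x` between `x` and `y` -/

/-- `θ − id` times the weight is integrable on bounded intervals `(x, y]`, `x > 1`. [folklore] -/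
private theorem integrableOn_theta_sub_mul_weight_Ioc {x y : ℝ} (hx : 1 < x) :
    IntegrableOn (fun t => (θ t - t) * mertensWeight t) (Ioc x y) := by
  by_cases hxy : x ≤ y
  swap
  · rw [Set.Ioc_eq_empty (by push Not at hxy; exact not_lt.mpr hxy.le)]; exact integrableOn_empty
  have hK : IsCompact (Set.Icc x y) := isCompact_Icc
  have hθ : IntegrableOn (fun t : ℝ => θ t - t) (Set.Icc x y) :=
    (Chebyshev.theta_mono.monotoneOn _).integrableOn_isCompact hK |>.sub
      (continuousOn_id.integrableOn_compact hK)
  have hsub : ∀ t ∈ Set.Icc x y, t ∈ ({0}ᶜ : Set ℝ) := fun t ht =>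
    Set.mem_compl_singleton_iff.mpr (show (0:ℝ) < t by linarith [ht.1]).ne'
  have h0 : ∀ t ∈ Set.Icc x y, t ^ 2 * Real.log t ^ 2 ≠ 0 := fun t ht =>
    mul_ne_zero (pow_ne_zero _ (by linarith [ht.1]))
      (pow_ne_zero _ (Real.log_pos (lt_of_lt_of_le hx ht.1)).ne')
  have hw : ContinuousOn mertensWeight (Set.Icc x y) := by
    refine ContinuousOn.div ?_ ?_ h0
    · exact continuousOn_const.add (Real.continuousOn_log.mono hsub)
    · exact (continuousOn_pow 2).mul ((Real.continuousOn_log.mono hsub).pow 2)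
  exact (hθ.mono_set Set.Ioc_subset_Icc_self).mul_continuousOn_of_subset hw measurableSet_Ioc hK
    Set.Ioc_subset_Icc_self

/-- For `2 ≤ x ≤ y`: `(P(y) − log log y) − (P(x) − log log x) =
(θ(y) − y)/(y log y) − (θ(x) − x)/(x log x) + ∫_x^y (θ(t) − t) w(t) dt`.
[cite: RosserSchoenfeld1962, (4.13)–(4.20)] -/
theorem primeRecipSum_sub_loglog_sub {x y : ℝ} (hx : 2 ≤ x) (hxy : x ≤ y) :
    (primeRecipSum y - Real.log (Real.log y)) - (primeRecipSum x - Real.log (Real.log x)) =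
      (θ y - y) / (y * Real.log y) - (θ x - x) / (x * Real.log x) +
        ∫ t in Ioc x y, (θ t - t) * mertensWeight t := by
  have hx1 : 1 < x := by linarith
  have h1 := primeRecipSum_sub_eq_theta hx hxy
  have h2 := integral_id_mul_mertensWeight hx1 hxy
  have hint1 := integrableOn_theta_sub_mul_weight_Ioc (y := y) hx1
  have hint2 : IntegrableOn (fun t => t * mertensWeight t) (Ioc x y) := by
    have : IntegrableOn (fun t => θ t * mertensWeight t) (Ioc x y) := by
      have hK : IsCompact (Set.Icc x y) := isCompact_Icc
      have hsub : ∀ t ∈ Set.Icc x y, t ∈ ({0}ᶜ : Set ℝ) := fun t ht =>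
        Set.mem_compl_singleton_iff.mpr (show (0:ℝ) < t by linarith [ht.1]).ne'
      have h0 : ∀ t ∈ Set.Icc x y, t ^ 2 * Real.log t ^ 2 ≠ 0 := fun t ht =>
        mul_ne_zero (pow_ne_zero _ (by linarith [ht.1]))
          (pow_ne_zero _ (Real.log_pos (lt_of_lt_of_le hx1 ht.1)).ne')
      have hw : ContinuousOn mertensWeight (Set.Icc x y) := by
        refine ContinuousOn.div ?_ ?_ h0
        · exact continuousOn_const.add (Real.continuousOn_log.mono hsub)
        · exact (continuousOn_pow 2).mul ((Real.continuousOn_log.mono hsub).pow 2)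
      exact ((Chebyshev.theta_mono.monotoneOn _).integrableOn_isCompact hK |>.mono_set
        Set.Ioc_subset_Icc_self).mul_continuousOn_of_subset hw measurableSet_Ioc hK Set.Ioc_subset_Icc_self
    have := this.sub hint1
    refine this.congr_fun (fun t _ => by simp only [Pi.sub_apply]; ring) measurableSet_Ioc
  have hsplit : ∫ t in Ioc x y, θ t * mertensWeight t =
      (∫ t in Ioc x y, (θ t - t) * mertensWeight t) + ∫ t in Ioc x y, t * mertensWeight t := by
    rw [← integral_add hint1 hint2]
    refine setIntegral_congr_fun measurableSet_Ioc fun t _ => by ring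
  have hy0 : y ≠ 0 := by linarith
  have hx0 : x ≠ 0 := by linarith
  have hly : Real.log y ≠ 0 := (Real.log_pos (by linarith)).ne'
  have hlx : Real.log x ≠ 0 := (Real.log_pos (by linarith)).ne'
  have e1 : θ y / (y * Real.log y) = (θ y - y) / (y * Real.log y) + (Real.log y)⁻¹ := by
    field_simp; ring
  have e2 : θ x / (x * Real.log x) = (θ x - x) / (x * Real.log x) + (Real.log x)⁻¹ := by
    field_simp; ring
  rw [hsplit, h2, e1, e2] at h1
  linarith

/-! ### Letting `y → ∞`: the exact remainder -/

/-- `(θ(y) − y)/(y log y) → 0` (Chebyshev's bound `θ(y) ≤ y log 4` suffices). [folklore] -/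
private theorem tendsto_theta_sub_div : Tendsto (fun y : ℝ => (θ y - y) / (y * Real.log y)) atTop (𝓝 0) := by
  have hlim : Tendsto (fun y : ℝ => 3 / Real.log y) atTop (𝓝 0) := by
    have := Real.tendsto_log_atTop.inv_tendsto_atTop.const_mul 3
    simpa [div_eq_mul_inv] using this
  refine squeeze_zero_norm' ?_ hlim
  filter_upwards [eventually_ge_atTop (2 : ℝ)] with y hy
  have hy0 : 0 < y := by linarith
  have hlog : 0 < Real.log y := Real.log_pos (by linarith)
  have hθ := Chebyshev.theta_le_log4_mul_x hy0.le
  have hθ0 := Chebyshev.theta_nonneg y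
  have hlog4 : Real.log 4 < 2 := by
    have : Real.log 4 < 4 - 1 - 0 := by
      have := Real.log_lt_sub_one_of_pos (by norm_num : (0:ℝ) < 4) (by norm_num)
      linarith
    have h4 : Real.log 4 = 2 * Real.log 2 := by
      rw [show (4:ℝ) = 2 ^ 2 by norm_num, Real.log_pow]; ring
    have h2 : Real.log 2 < 1 := by
      have := Real.log_two_lt_d9; linarith
    linarith
  have habs : |θ y - y| ≤ 3 * y := by
    rw [abs_le]; constructor <;> nlinarith
  rw [Real.norm_eq_abs, abs_div, abs_of_pos (mul_pos hy0 hlog)]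
  rw [div_le_div_iff₀ (mul_pos hy0 hlog) hlog]
  nlinarith

/-- **Mertens' second theorem with Rosser–Schoenfeld's exact remainder**: if
`(θ(t) − t) w(t)` is integrable on `(x, ∞)` (`x ≥ 2`), then
`∑_{p≤x} 1/p − log log x = B₁ + (θ(x) − x)/(x log x) − ∫_x^∞ (θ(t) − t) w(t) dt`.
[cite: RosserSchoenfeld1962, (4.20)] -/
theorem primeRecipSum_sub_loglog_eq {x : ℝ} (hx : 2 ≤ x)
    (hint : IntegrableOn (fun t => (θ t - t) * mertensWeight t) (Ioi x)) :
    primeRecipSum x - Real.log (Real.log x) = meisselMertens + mertensRemainder x := by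
  set g : ℝ → ℝ := fun t => (θ t - t) * mertensWeight t with hg
  set c : ℝ := (θ x - x) / (x * Real.log x) with hc
  set D : ℝ → ℝ := fun z => primeRecipSum z - Real.log (Real.log z) with hD
  -- the integral over `(x, y]` tends to the integral over `(x, ∞)`
  have hI : Tendsto (fun y => ∫ t in Ioc x y, g t) atTop (𝓝 (∫ t in Ioi x, g t)) := by
    have h := intervalIntegral_tendsto_integral_Ioi x hint tendsto_id
    refine h.congr' ?_
    filter_upwards [eventually_ge_atTop x] with y hy
    simp only [id, intervalIntegral.integral_of_le hy]
  -- `D y = D x + (θ y − y)/(y log y) − c + ∫_{(x,y]} g` for `y ≥ x`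
  have hDy : ∀ᶠ y in atTop, D y = D x + ((θ y - y) / (y * Real.log y) - c + ∫ t in Ioc x y, g t) := by
    filter_upwards [eventually_ge_atTop x] with y hy
    have := primeRecipSum_sub_loglog_sub hx hy
    simp only [hD, hc, hg]
    linarith
  have hlim2 : Tendsto D atTop (𝓝 (D x + (0 - c + ∫ t in Ioi x, g t))) := by
    refine Tendsto.congr' (EventuallyEq.symm hDy) ?_
    exact tendsto_const_nhds.add ((tendsto_theta_sub_div.sub tendsto_const_nhds).add hI)
  have hlim1 : Tendsto D atTop (𝓝 meisselMertens) := tendsto_primeRecipSum_sub_loglog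
  have := tendsto_nhds_unique hlim1 hlim2
  simp only [mertensRemainder, hD, hc, hg] at this ⊢
  linarith

/-! ### The product bound -/

/-- The terms `d_k = −log(1 − 1/k) − 1/k` (`k` prime) are nonnegative. [folklore] -/
private theorem primeLogCoeffSubInv_nonneg (k : ℕ) : 0 ≤ primeLogCoeffSubInv k := by
  unfold primeLogCoeffSubInv
  split_ifs with hk
  · have hk2 : (2 : ℝ) ≤ k := by exact_mod_cast hk.two_le
    have hpos : 0 < 1 - (k : ℝ)⁻¹ := by
      have : (k : ℝ)⁻¹ ≤ 1 / 2 := by rw [inv_eq_one_div]; exact one_div_le_one_div_of_le (by norm_num) hk2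
      linarith
    have := Real.log_le_sub_one_of_pos hpos
    linarith
  · exact le_rfl

/-- `∑_k d_k = γ − B₁`. [cite: HardyWright2008, Thm 428 (§22.8) eq. (22.8.1)] -/
theorem tsum_primeLogCoeffSubInv_eq : ∑' k, primeLogCoeffSubInv k = eulerMascheroniConstant - meisselMertens := by
  rw [tsum_primeLogCoeffSubInv, meisselMertens]
  ring

/-- **Mertens' product with explicit remainder** (logarithmic form): for `x ≥ 2` with
`(θ − id)·w` integrable on `(x, ∞)`,
`∑_{p≤x} −log(1 − 1/p) ≤ log log x + γ + E(x)`, `E = mertensRemainder`.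
[cite: RosserSchoenfeld1962, (4.20)] -/
theorem mertensLog_sub_loglog_le {x : ℝ} (hx : 2 ≤ x)
    (hint : IntegrableOn (fun t => (θ t - t) * mertensWeight t) (Ioi x)) :
    Literature.NumberTheory.LFunctions.Nicolas.mertensLog x ≤
      Real.log (Real.log x) + eulerMascheroniConstant + mertensRemainder x := by
  have h1 := primeRecipSum_sub_loglog_eq hx hint
  have h2 := mertensLog_sub_primeRecipSum x
  have h3 : ∑ k ∈ Finset.range (⌊x⌋₊ + 1), primeLogCoeffSubInv k ≤ ∑' k, primeLogCoeffSubInv k :=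
    summable_primeLogCoeffSubInv.sum_le_tsum _ fun k _ => primeLogCoeffSubInv_nonneg k
  rw [tsum_primeLogCoeffSubInv_eq] at h3
  linarith

/-- **Mertens' product with explicit remainder**: for `x ≥ 2` with `(θ − id)·w` integrable on
`(x, ∞)`, `∏_{p≤x} (1 − 1/p)⁻¹ ≤ e^γ · log x · exp(E(x))`, `E = mertensRemainder`
(the form of Morrill–Platt 2021, Lemma 5 / Axler 2023, §2, before θ-bounds are inserted).
[cite: RosserSchoenfeld1962, (4.20)] -/
theorem prod_one_sub_inv_inv_le {x : ℝ} (hx : 2 ≤ x)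
    (hint : IntegrableOn (fun t => (θ t - t) * mertensWeight t) (Ioi x)) :
    ∏ p ∈ Nat.primesLE ⌊x⌋₊, (1 - (p : ℝ)⁻¹)⁻¹ ≤
      Real.exp eulerMascheroniConstant * Real.log x * Real.exp (mertensRemainder x) := by
  have h := mertensLog_sub_loglog_le hx hint
  have hlog : 0 < Real.log x := Real.log_pos (by linarith)
  rw [← Literature.NumberTheory.LFunctions.Nicolas.exp_mertensLog_natCast,
    ← Literature.NumberTheory.LFunctions.Nicolas.mertensLog_eq_natCast_floor,
    ← Real.exp_log hlog, ← Real.exp_add, ← Real.exp_add]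
  exact Real.exp_le_exp.mpr (by linarith)

end RobinTFree

end Literature.NumberTheory.LFunctions
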